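import Literature.Probability.LatticeModels.IsingAnnulusCircuitFK
import Literature.Probability.LatticeModels.StarCrossing
import HarnessLib

/-!
# The insulated circuit: its clusters avoid the wired set and block every `∗`-path across the annulus

Topic `Literature/Probability/LatticeModels` (family `crit-ising`). Deterministic companion of
`IsingAnnulusCircuitFK.lean`. For a finite graph `G` with lattice edges under `ι : V ↪ ℤ²`,
wired on a set `B` of vertices at sup-norm levels `≤ n` or `≥ 29n` around `x₀`, and a
configuration `ω` in the event `insulatedCircuitEvent G ι x₀ n` (no open crossing of the bands of
levels `[n, 5n]` and `[13n, 29n]`, and open long-way crossings of the four `24n × 6n` rectangles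
forming `x₀ + S_{6n,12n}`), `insulatedCircuitEvent_seeds` provides four seed vertices (the
starting points of the four crossings) such that

* no seed is joined to `B` by an open path (an open path from level `12n` to level `≤ n` crosses
  the band `[n, 5n]` inside the band, `exists_walk_in_band`; likewise outwards);
* every `∗`-walk of `ℤ²` (king moves, `zdStarGraph`) from a site of level `< 6n` to a site of
  level `> 12n` passes through the position of a vertex joined to one of the seeds by an open
  path: its piece inside `S_{6n,12n}` after the last visit to the inner square contains a
  short-way `∗`-crossing of one of the four rectangles (Duminil-Copin–Smirnov 2012, proof of
  Lemma 6.3, "one can construct from them a circuit", read for `∗`-paths), which meets the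
  long-way lattice crossing of that rectangle (the matching property of `(ℤ², ℤ²*)`,
  `exists_mem_support_of_crossing_star`, Kesten 1982 §2.2 / Georgii–Higuchi 2000 §2).

In the Edwards–Sokal coupling these seeds are coloured `-1` with probability `≥ 1/16`, which
yields a `-1` set blocking all `+∗`-crossings of the annulus (`IsingAnnulusCircuit.lean`).

## References

* H. Duminil-Copin, S. Smirnov, Clay Math. Proc. 15 (2012), proof of Lemma 6.3 — `DuminilCopinSmirnov2012Clay`.
* H.-O. Georgii, Y. Higuchi, J. Math. Phys. 41 (2000), §2 (`∗`-paths vs paths) — `GeorgiiHiguchi2000`.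
* H. Kesten, *Percolation theory for mathematicians* (1982), §2.2 — `KestenPTM1982`.
-/

noncomputable section

namespace Literature.Probability.LatticeModels

open Finset SimpleGraph Literature.Probability.Percolation

/-! ### Walks between two levels, with control of the support -/

section Trim

variable {V : Type*} {H : SimpleGraph V} (ℓ : V → ℤ)

/-- **Prefix up to the first visit of a level.** If `ℓ` increases by at most `1` along edges and
a walk runs from level `≤ hi` to level `≥ hi`, an initial segment ends at a vertex of level
exactly `hi` and stays at levels `≤ hi`. [folklore] -/
theorem exists_prefix_to_level (hH : ∀ ⦃u v : V⦄, H.Adj u v → ℓ v ≤ ℓ u + 1) {hi : ℤ} {a b : V}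
    (π : H.Walk a b) (ha : ℓ a ≤ hi) (hb : hi ≤ ℓ b) :
    ∃ (v : V) (π₁ : H.Walk a v), ℓ v = hi ∧ (∀ z ∈ π₁.support, ℓ z ≤ hi) ∧ π₁.support ⊆ π.support := by
  induction π with
  | nil => exact ⟨_, .nil, le_antisymm ha hb, by simpa using ha, by simp⟩
  | @cons u u₁ w hadj π' ih =>
    by_cases hu : ℓ u = hi
    · exact ⟨u, .nil, hu, by simpa using ha, by simp⟩
    · have hu₁ : ℓ u₁ ≤ hi := by have := hH hadj; omega
      obtain ⟨v, π₁, hv, hle, hsub⟩ := ih hu₁ hb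
      refine ⟨v, .cons hadj π₁, hv, fun z hz ↦ ?_, fun z hz ↦ ?_⟩
      · rw [Walk.support_cons, List.mem_cons] at hz
        rcases hz with rfl | hz
        · exact ha
        · exact hle z hz
      · rw [Walk.support_cons, List.mem_cons] at hz ⊢
        rcases hz with rfl | hz
        · exact Or.inl rfl
        · exact Or.inr (hsub hz)

/-- **Suffix after the last visit of a level.** If `ℓ` decreases by at most `1` along edges and a
walk runs from level `≤ lo` to level `≥ lo`, a final segment starts at a vertex of level exactly
`lo` and stays at levels `≥ lo`. [folklore] -/
theorem exists_suffix_from_level (hH : ∀ ⦃u v : V⦄, H.Adj u v → ℓ u ≤ ℓ v + 1) {lo : ℤ} {a b : V}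
    (π : H.Walk a b) (ha : ℓ a ≤ lo) (hb : lo ≤ ℓ b) :
    ∃ (u : V) (π₂ : H.Walk u b), ℓ u = lo ∧ (∀ z ∈ π₂.support, lo ≤ ℓ z) ∧ π₂.support ⊆ π.support := by
  have hH' : ∀ ⦃u v : V⦄, H.Adj u v → -ℓ v ≤ -ℓ u + 1 := fun u v h ↦ by have := hH h; omega
  obtain ⟨u, π₁, hu, hle, hsub⟩ := exists_prefix_to_level (fun z ↦ -ℓ z) hH' π.reverse
    (hi := -lo) (by omega) (by omega)
  refine ⟨u, π₁.reverse, by omega, fun z hz ↦ ?_, fun z hz ↦ ?_⟩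
  · rw [Walk.support_reverse, List.mem_reverse] at hz
    have := hle z hz; omega
  · rw [Walk.support_reverse, List.mem_reverse] at hz
    have := hsub hz
    rwa [Walk.support_reverse, List.mem_reverse] at this

/-- **A walk across a band of levels contains a sub-walk inside the band**, from the lower level
to the upper level, for a `1`-Lipschitz level function. [folklore] -/
theorem exists_subwalk_in_band (hH : ∀ ⦃u v : V⦄, H.Adj u v → ℓ v ≤ ℓ u + 1) {lo hi : ℤ} (hlh : lo ≤ hi)
    {a b : V} (π : H.Walk a b) (ha : ℓ a ≤ lo) (hb : hi ≤ ℓ b) :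
    ∃ (u v : V) (π' : H.Walk u v), ℓ u = lo ∧ ℓ v = hi ∧
      (∀ z ∈ π'.support, lo ≤ ℓ z ∧ ℓ z ≤ hi) ∧ π'.support ⊆ π.support := by
  have hH' : ∀ ⦃u v : V⦄, H.Adj u v → ℓ u ≤ ℓ v + 1 := fun u v h ↦ hH h.symm
  obtain ⟨v, π₁, hv, hle, hsub⟩ := exists_prefix_to_level ℓ hH π (ha.trans hlh) hb
  obtain ⟨u, π₂, hu, hge, hsub₂⟩ := exists_suffix_from_level ℓ hH' π₁ ha (hv ▸ hlh)
  exact ⟨u, v, π₂, hu, hv, fun z hz ↦ ⟨hge z hz, hle z (hsub₂ hz)⟩, fun z hz ↦ hsub (hsub₂ hz)⟩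

/-- All vertices of a walk satisfy a property that holds at the start and is forced at the far
end of every edge. [folklore] -/
theorem forall_mem_support_of_adj {Q : V → Prop} (hQ : ∀ ⦃x y : V⦄, H.Adj x y → Q y) {a b : V}
    (π : H.Walk a b) (ha : Q a) : ∀ z ∈ π.support, Q z := by
  induction π with
  | nil => simpa using ha
  | @cons u u₁ w hadj π' ih =>
    intro z hz
    rw [Walk.support_cons, List.mem_cons] at hz
    rcases hz with rfl | hz
    · exact ha
    · exact ih (hQ hadj) z hz

end Trim

/-! ### The `∗`-graph: Lipschitz coordinates and the transposition -/

section Star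

/-- Along a `∗`-edge each coordinate changes by at most `1`. [cite: GeorgiiHiguchi2000, §2 p. 4] -/
theorem abs_sub_le_one_of_zdStarGraph_adj {u v : Site 2} (h : zdStarGraph.Adj u v) (i : Fin 2) :
    |u i - v i| ≤ 1 := (zdStarGraph_adj.1 h).2 i

/-- The sup-norm level is `1`-Lipschitz along `∗`-edges. [folklore] -/
theorem supLevel_le_of_zdStarGraph_adj (x₀ : Site 2) {u v : Site 2} (h : zdStarGraph.Adj u v) :
    supLevel x₀ v ≤ supLevel x₀ u + 1 := by
  have h0 := abs_le.1 (abs_sub_le_one_of_zdStarGraph_adj h 0)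
  have h1 := abs_le.1 (abs_sub_le_one_of_zdStarGraph_adj h 1)
  unfold supLevel
  have a0 := abs_le.1 (le_max_left |(u - x₀) 0| |(u - x₀) 1|)
  have a1 := abs_le.1 (le_max_right |(u - x₀) 0| |(u - x₀) 1|)
  simp only [Pi.sub_apply] at a0 a1 ⊢
  refine max_le ?_ ?_ <;> rw [abs_le] <;> constructor <;> omega

/-- An outward coordinate `ε (z - x₀)_i` is `1`-Lipschitz along `∗`-edges. [folklore] -/
theorem units_mul_sub_le_of_zdStarGraph_adj (x₀ : Site 2) (i : Fin 2) (ε : ℤˣ) {u v : Site 2}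
    (h : zdStarGraph.Adj u v) : (ε : ℤ) * (v - x₀) i ≤ (ε : ℤ) * (u - x₀) i + 1 := by
  have h' := abs_le.1 (abs_sub_le_one_of_zdStarGraph_adj h i)
  simp only [Pi.sub_apply]
  rcases Int.units_eq_one_or ε with rfl | rfl
  · simp only [Units.val_one, one_mul]; omega
  · simp only [Units.val_neg, Units.val_one, neg_mul, one_mul]; omega

/-- The transposition `(z₀, z₁) ↦ (z₁, z₀)` as a homomorphism of the `∗`-graph. [folklore] -/
def starTransposeHom : zdStarGraph →g zdStarGraph where
  toFun z := ![z 1, z 0]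
  map_rel' {x y} h := by
    rw [zdStarGraph_adj_iff] at h ⊢
    simp only [Matrix.cons_val_zero, Matrix.cons_val_one]
    exact ⟨h.1.symm, h.2.2, h.2.1⟩

/-- The transposition of the `∗`-graph is injective. [folklore] -/
theorem starTransposeHom_injective : Function.Injective starTransposeHom := by
  intro x y h
  have h0 := congr_fun h 0
  have h1 := congr_fun h 1
  simp only [starTransposeHom, RelHom.coeFn_mk, Matrix.cons_val_zero, Matrix.cons_val_one] at h0 h1
  ext i; fin_cases i <;> assumption

/-- Coordinates of the transposed site. [folklore] -/
@[simp] theorem starTransposeHom_apply_zero (z : Site 2) : starTransposeHom z 0 = z 1 := rfl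

/-- Coordinates of the transposed site. [folklore] -/
@[simp] theorem starTransposeHom_apply_one (z : Site 2) : starTransposeHom z 1 = z 0 := rfl

/-- The lattice transposition and the `∗`-transposition agree on sites. [folklore] -/
theorem transposeIso_apply_eq (z : Site 2) : (transposeIso z : Site 2) = starTransposeHom z := by
  rw [transposeIso_apply]; rfl

end Star

/-! ### Blocking: a `∗`-walk across `S_{6n,12n}` meets one of the four long crossings -/

section Block

variable {V : Type*} [Fintype V] [DecidableEq V] (G : SimpleGraph V) [DecidableRel G.Adj]
  (ι : V ↪ Site 2) (x₀ : Site 2)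

/-- **A transversal `∗`-crossing of a rectangle meets its long lattice crossing, in each of the
four orientations.** Let `P` be a lattice walk inside the rectangle `(i, ε)` (coordinates
`y = z - x₀`: `6n ≤ ε y_i ≤ 12n`, `|y_{1-i}| ≤ 12n`) from the short side `y_{1-i} = -12n` to the
short side `y_{1-i} = 12n`, and `Q` a `∗`-walk inside the same rectangle from the long side
`ε y_i = 6n` to the long side `ε y_i = 12n`. Then they have a common site
(`exists_mem_support_of_crossing_star` after a reflection / transposition).
[cite: GeorgiiHiguchi2000, §2 p. 4] -/
theorem exists_mem_support_rect_star {n : ℕ} (i : Fin 2) (ε : ℤˣ) {a b c d : Site 2}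
    (P : (zdGraph 2).Walk a b) (Q : zdStarGraph.Walk c d)
    (hP : ∀ z ∈ P.support, InRect n i ε (z - x₀)) (hQ : ∀ z ∈ Q.support, InRect n i ε (z - x₀))
    (ha : (a - x₀) i.rev = -(12 * n)) (hb : (b - x₀) i.rev = 12 * n)
    (hc : (ε : ℤ) * (c - x₀) i = 6 * n) (hd : (ε : ℤ) * (d - x₀) i = 12 * n) :
    ∃ z ∈ P.support, z ∈ Q.support := by
  have hi : i = 0 ∨ i = 1 := by fin_cases i <;> simp
  -- bounds in the two coordinates
  have bd : ∀ z : Site 2, InRect n i ε (z - x₀) →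
      (6 * (n : ℤ) ≤ (ε : ℤ) * (z i - x₀ i) ∧ (ε : ℤ) * (z i - x₀ i) ≤ 12 * n) ∧
        (-(12 * (n : ℤ)) ≤ z i.rev - x₀ i.rev ∧ z i.rev - x₀ i.rev ≤ 12 * n) := by
    intro z hz
    obtain ⟨h1, h2, h3⟩ := hz
    simp only [Pi.sub_apply] at h1 h2 h3
    exact ⟨⟨h1, h2⟩, abs_le.1 h3⟩
  rcases hi with rfl | rfl
  · -- `i = 0`: transpose; the lattice crossing is vertical, the `∗`-crossing horizontal
    have hrev : (0 : Fin 2).rev = 1 := by decide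
    rw [hrev] at ha hb bd
    set τ : zdGraph 2 →g zdGraph 2 := transposeIso.toHom with hτ
    have hτa : ∀ z : Site 2, (τ z : Site 2) = starTransposeHom z := fun z ↦ transposeIso_apply_eq z
    rcases Int.units_eq_one_or ε with rfl | rfl
    · -- right rectangle
      simp only [Units.val_one, one_mul] at hc hd bd
      obtain ⟨z, hzP, hzQ⟩ := exists_mem_support_of_crossing_star (L := x₀ 1 - 12 * n)
        (R := x₀ 1 + 12 * n) (B := x₀ 0 + 6 * n) (T := x₀ 0 + 12 * n)
        (P.map τ) (Q.map starTransposeHom)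
        (fun z hz ↦ by
          rw [Walk.support_map, List.mem_map] at hz
          obtain ⟨w, hw, rfl⟩ := hz
          have h := bd w (hP w hw)
          rw [hτa]; simp only [starTransposeHom_apply_zero, starTransposeHom_apply_one]; omega)
        (fun z hz ↦ by
          rw [Walk.support_map, List.mem_map] at hz
          obtain ⟨w, hw, rfl⟩ := hz
          have h := bd w (hQ w hw)
          simp only [starTransposeHom_apply_zero, starTransposeHom_apply_one]; omega)
        (by rw [hτa]; simp only [starTransposeHom_apply_zero]; simp only [Pi.sub_apply] at ha; omega)
        (by rw [hτa]; simp only [starTransposeHom_apply_zero]; simp only [Pi.sub_apply] at hb; omega)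
        (by simp only [starTransposeHom_apply_one]; simp only [Pi.sub_apply] at hc; omega)
        (by simp only [starTransposeHom_apply_one]; simp only [Pi.sub_apply] at hd; omega)
      rw [Walk.support_map, List.mem_map] at hzP hzQ
      obtain ⟨w, hw, hwz⟩ := hzP
      obtain ⟨w', hw', hw'z⟩ := hzQ
      rw [hτa] at hwz
      have : w = w' := starTransposeHom_injective (hwz.trans hw'z.symm)
      exact ⟨w, hw, this ▸ hw'⟩
    · -- left rectangle: reverse the `∗`-walk
      simp only [Units.val_neg, Units.val_one, neg_mul, one_mul] at hc hd bd
      obtain ⟨z, hzP, hzQ⟩ := exists_mem_support_of_crossing_star (L := x₀ 1 - 12 * n)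
        (R := x₀ 1 + 12 * n) (B := x₀ 0 - 12 * n) (T := x₀ 0 - 6 * n)
        (P.map τ) (Q.reverse.map starTransposeHom)
        (fun z hz ↦ by
          rw [Walk.support_map, List.mem_map] at hz
          obtain ⟨w, hw, rfl⟩ := hz
          have h := bd w (hP w hw)
          rw [hτa]; simp only [starTransposeHom_apply_zero, starTransposeHom_apply_one]; omega)
        (fun z hz ↦ by
          rw [Walk.support_map, List.mem_map] at hz
          obtain ⟨w, hw, rfl⟩ := hz
          rw [Walk.support_reverse, List.mem_reverse] at hw
          have h := bd w (hQ w hw)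
          simp only [starTransposeHom_apply_zero, starTransposeHom_apply_one]; omega)
        (by rw [hτa]; simp only [starTransposeHom_apply_zero]; simp only [Pi.sub_apply] at ha; omega)
        (by rw [hτa]; simp only [starTransposeHom_apply_zero]; simp only [Pi.sub_apply] at hb; omega)
        (by simp only [starTransposeHom_apply_one]; simp only [Pi.sub_apply] at hd; omega)
        (by simp only [starTransposeHom_apply_one]; simp only [Pi.sub_apply] at hc; omega)
      rw [Walk.support_map, List.mem_map] at hzP hzQ
      obtain ⟨w, hw, hwz⟩ := hzP
      obtain ⟨w', hw', hw'z⟩ := hzQ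
      rw [Walk.support_reverse, List.mem_reverse] at hw'
      rw [hτa] at hwz
      have : w = w' := starTransposeHom_injective (hwz.trans hw'z.symm)
      exact ⟨w, hw, this ▸ hw'⟩
  · -- `i = 1`: the lattice crossing is horizontal, the `∗`-crossing vertical
    have hrev : (1 : Fin 2).rev = 0 := by decide
    rw [hrev] at ha hb bd
    rcases Int.units_eq_one_or ε with rfl | rfl
    · -- top rectangle
      simp only [Units.val_one, one_mul] at hc hd bd
      exact exists_mem_support_of_crossing_star (L := x₀ 0 - 12 * n) (R := x₀ 0 + 12 * n)
        (B := x₀ 1 + 6 * n) (T := x₀ 1 + 12 * n) P Q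
        (fun z hz ↦ by have h := bd z (hP z hz); omega)
        (fun z hz ↦ by have h := bd z (hQ z hz); omega)
        (by simp only [Pi.sub_apply] at ha; omega) (by simp only [Pi.sub_apply] at hb; omega)
        (by simp only [Pi.sub_apply] at hc; omega) (by simp only [Pi.sub_apply] at hd; omega)
    · -- bottom rectangle: reverse the `∗`-walk
      simp only [Units.val_neg, Units.val_one, neg_mul, one_mul] at hc hd bd
      obtain ⟨z, hzP, hzQ⟩ := exists_mem_support_of_crossing_star (L := x₀ 0 - 12 * n)
        (R := x₀ 0 + 12 * n) (B := x₀ 1 - 12 * n) (T := x₀ 1 - 6 * n) P Q.reverse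
        (fun z hz ↦ by have h := bd z (hP z hz); omega)
        (fun z hz ↦ by
          rw [Walk.support_reverse, List.mem_reverse] at hz
          have h := bd z (hQ z hz); omega)
        (by simp only [Pi.sub_apply] at ha; omega) (by simp only [Pi.sub_apply] at hb; omega)
        (by simp only [Pi.sub_apply] at hd; omega) (by simp only [Pi.sub_apply] at hc; omega)
      rw [Walk.support_reverse, List.mem_reverse] at hzQ
      exact ⟨z, hzP, hzQ⟩

end Block

/-! ### The seeds of the insulated circuit -/

section Seeds

variable {V : Type*} [Fintype V] [DecidableEq V] (G : SimpleGraph V) [DecidableRel G.Adj]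
  (ι : V ↪ Site 2) (x₀ : Site 2)

/-- The other coordinate is bounded by the sup-norm level. [folklore] -/
theorem abs_rev_le_supLevel (i : Fin 2) (z : Site 2) : |(z - x₀) i.rev| ≤ supLevel x₀ z := by
  unfold supLevel
  have hi : i = 0 ∨ i = 1 := by fin_cases i <;> simp
  rcases hi with rfl | rfl
  · exact le_max_right _ _
  · exact le_max_left _ _

omit [DecidableEq V] in
/-- A vertex of the short side `y_{1-i} = -12n` of a rectangle is at level `12n`. [folklore] -/
theorem supLevel_eq_of_mem_rectIn {n : ℕ} {i : Fin 2} {ε : ℤˣ} {v : V} (hv : v ∈ rectIn ι x₀ n i ε) :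
    supLevel x₀ (ι v) = 12 * n := by
  rw [rectIn, Finset.mem_filter] at hv
  obtain ⟨-, hin, hside⟩ := hv
  have hle := (supLevel_mem_of_inRect x₀ hin).2
  have hge : 12 * (n : ℤ) ≤ supLevel x₀ (ι v) := by
    have h := abs_rev_le_supLevel x₀ i (ι v)
    rw [hside, abs_neg] at h
    have : |(12 * (n : ℤ))| = 12 * n := abs_of_nonneg (by positivity)
    omega
  exact le_antisymm hle hge

/-- **A long-way region crossing of a rectangle, as a lattice walk inside the rectangle** whose
sites are positions of vertices in the local open cluster of its starting point. [folklore] -/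
theorem exists_walk_of_mem_rectCross (hGlat : ∀ u v : V, G.Adj u v → (zdGraph 2).Adj (ι u) (ι v))
    {n : ℕ} {i : Fin 2} {ε : ℤˣ} {ω : Percolation.BondConfig V} (hω : ω ∈ rectCross G ι x₀ n i ε) :
    ∃ a : V, a ∈ rectIn ι x₀ n i ε ∧ ∃ (b : V) (P : (zdGraph 2).Walk (ι a) (ι b)),
      b ∈ rectOut ι x₀ n i ε ∧ (∀ z ∈ P.support, InRect n i ε (z - x₀)) ∧
      ∀ z ∈ P.support, ∃ v, ι v = z ∧ (openGraph ω).Reachable a v := by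
  classical
  obtain ⟨a, ha, b, hb, ⟨p⟩⟩ := hω
  set E := rectEdges G ι x₀ n i ε with hE
  have hadjE : ∀ ⦃x y : V⦄, (regionGraph E ω).Adj x y → s(x, y) ∈ E ∧ s(x, y) ∈ ω := fun x y h ↦
    ⟨(regionGraph_adj.1 h).2.1, (regionGraph_adj.1 h).1⟩
  let f : regionGraph E ω →g zdGraph 2 :=
    { toFun := ι
      map_rel' := fun {x y} h ↦ by
        have hmem := (hadjE h).1
        rw [hE, rectEdges, Finset.mem_filter, mem_edgeFinset] at hmem
        exact hGlat x y hmem.1 }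
  have hle : regionGraph E ω ≤ openGraph ω := fun x y h ↦ by
    rw [openGraph_adj]
    exact ⟨(regionGraph_adj.1 h).1, (regionGraph_adj.1 h).2.2⟩
  have hQ : ∀ ⦃x y : V⦄, (regionGraph E ω).Adj x y → InRect n i ε (ι y - x₀) := fun x y h ↦ by
    have hmem := (hadjE h).1
    rw [hE, rectEdges, Finset.mem_filter] at hmem
    exact hmem.2 y (Sym2.mem_mk_right x y)
  have ha' : InRect n i ε (ι a - x₀) := by
    rw [rectIn, Finset.mem_filter] at ha; exact ha.2.1
  have hsupp := forall_mem_support_of_adj hQ p ha'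
  refine ⟨a, ha, b, p.map f, hb, fun z hz ↦ ?_, fun z hz ↦ ?_⟩
  · rw [Walk.support_map, List.mem_map] at hz
    obtain ⟨w, hw, rfl⟩ := hz
    exact hsupp w hw
  · rw [Walk.support_map, List.mem_map] at hz
    obtain ⟨w, hw, rfl⟩ := hz
    exact ⟨w, rfl, ((p.takeUntil w hw).reachable).mono hle⟩

/-- **The seeds of the insulated circuit** (the geometric input of the coin flip). For `ω` in
`insulatedCircuitEvent G ι x₀ n` (edges of `G` lattice edges under `ι`, wired set `B` at levels
`≤ n` or `≥ 29n`, `n ≥ 1`) there are four vertices `s(i, ε)` — the starting points of the four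
long-way crossings — such that (a) no `s(i, ε)` is joined to `B` by an open path (such a path
would cross the band `[n, 5n]` or `[13n, 29n]` inside the band, `exists_walk_in_band`), and
(b) every `∗`-walk of `ℤ²` from level `< 6n` to level `> 12n` around `x₀` passes through the
position of a vertex joined to some `s(i, ε)` by an open path (its last excursion across
`S_{6n,12n}` contains a short-way `∗`-crossing of one of the four rectangles, which meets the
long-way lattice crossing of that rectangle: Duminil-Copin–Smirnov 2012, proof of Lemma 6.3, and
the matching property of `(ℤ², ℤ²*)`). [cite: DuminilCopinSmirnov2012Clay, proof of Lemma 6.3] -/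
theorem insulatedCircuitEvent_seeds (hGlat : ∀ u v : V, G.Adj u v → (zdGraph 2).Adj (ι u) (ι v))
    {n : ℕ} (hn : 1 ≤ n) (B : Set V)
    (hB : ∀ v ∈ B, supLevel x₀ (ι v) ≤ n ∨ 29 * (n : ℤ) ≤ supLevel x₀ (ι v))
    {ω : Percolation.BondConfig V} (hωE : ω ⊆ G.edgeSet) (hω : ω ∈ insulatedCircuitEvent G ι x₀ n) :
    ∃ s : Fin 2 → ℤˣ → V,
      (∀ i ε, ¬ ∃ w ∈ B, (openGraph ω).Reachable (s i ε) w) ∧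
      ∀ (a b : Site 2) (π : zdStarGraph.Walk a b), supLevel x₀ a < 6 * n → 12 * (n : ℤ) < supLevel x₀ b →
        ∃ z ∈ π.support, ∃ (i : Fin 2) (ε : ℤˣ) (v : V), ι v = z ∧ (openGraph ω).Reachable (s i ε) v := by
  classical
  obtain ⟨hC₁, hO, hC₃⟩ := hω
  rw [Set.mem_compl_iff] at hC₁ hC₃
  have hx : ∀ (i : Fin 2) (ε : ℤˣ), ∃ a : V, a ∈ rectIn ι x₀ n i ε ∧ ∃ (b : V) (P : (zdGraph 2).Walk (ι a) (ι b)),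
      b ∈ rectOut ι x₀ n i ε ∧ (∀ z ∈ P.support, InRect n i ε (z - x₀)) ∧
      ∀ z ∈ P.support, ∃ v, ι v = z ∧ (openGraph ω).Reachable a v := by
    intro i ε
    have h : ω ∈ rectCross G ι x₀ n i ε := by
      have := Set.mem_iInter.1 hO i
      exact Set.mem_iInter.1 this ε
    exact exists_walk_of_mem_rectCross G ι x₀ hGlat h
  choose s hsIn b P hbOut hPin hPreach using hx
  -- the level is `1`-Lipschitz along open edges
  have hL : ∀ ⦃u v : V⦄, (openGraph ω).Adj u v → supLevel x₀ (ι u) ≤ supLevel x₀ (ι v) + 1 := by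
    intro u v huv
    rw [openGraph_adj] at huv
    have hadj : G.Adj u v := (mem_edgeSet G).1 (hωE huv.1)
    exact supLevel_le_of_adj x₀ (hGlat u v hadj)
  -- a band reachability is a region crossing of the band
  have hband : ∀ {lo hi : ℤ} {u v : V},
      (SimpleGraph.fromRel fun s t ↦ (openGraph ω).Adj s t ∧ lo ≤ supLevel x₀ (ι s) ∧
        supLevel x₀ (ι s) ≤ hi ∧ lo ≤ supLevel x₀ (ι t) ∧ supLevel x₀ (ι t) ≤ hi).Reachable u v →
      (regionGraph (bandEdges G ι x₀ lo hi) ω).Reachable u v := by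
    intro lo hi u v h
    refine h.mono fun s t hst ↦ ?_
    rw [fromRel_adj] at hst
    obtain ⟨hne, h'⟩ := hst
    have key : ∀ {s t : V}, (openGraph ω).Adj s t ∧ lo ≤ supLevel x₀ (ι s) ∧ supLevel x₀ (ι s) ≤ hi ∧
        lo ≤ supLevel x₀ (ι t) ∧ supLevel x₀ (ι t) ≤ hi → (regionGraph (bandEdges G ι x₀ lo hi) ω).Adj s t := by
      rintro s t ⟨hadj, h1, h2, h3, h4⟩
      rw [openGraph_adj] at hadj
      rw [regionGraph_adj, mem_bandEdges, mem_edgeFinset]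
      refine ⟨hadj.1, ⟨hωE hadj.1, fun w hw ↦ ?_⟩, hadj.2⟩
      rcases Sym2.mem_iff.1 hw with rfl | rfl
      · exact ⟨h1, h2⟩
      · exact ⟨h3, h4⟩
    rcases h' with h' | h'
    · exact key h'
    · exact (key h').symm
  refine ⟨s, fun i ε ↦ ?_, fun a₀ b₀ π ha₀ hb₀ ↦ ?_⟩
  · -- (a) the seeds are not joined to the wired set
    rintro ⟨w, hwB, hreach⟩
    have hs : supLevel x₀ (ι (s i ε)) = 12 * n := supLevel_eq_of_mem_rectIn ι x₀ (hsIn i ε)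
    rcases hB w hwB with hw | hw
    · obtain ⟨u, v, hu, hv, huv⟩ := exists_walk_in_band (fun z ↦ supLevel x₀ (ι z)) hL
        (a := n) (b := 5 * n) (by omega) hw (by rw [hs]; omega) hreach.symm
      exact hC₁ ⟨u, (mem_supLevelSet ι x₀).2 hu, v, (mem_supLevelSet ι x₀).2 hv, hband huv⟩
    · obtain ⟨u, v, hu, hv, huv⟩ := exists_walk_in_band (fun z ↦ supLevel x₀ (ι z)) hL
        (a := 13 * n) (b := 29 * n) (by omega) (by rw [hs]; omega) hw hreach
      exact hC₃ ⟨u, (mem_supLevelSet ι x₀).2 hu, v, (mem_supLevelSet ι x₀).2 hv, hband huv⟩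
  · -- (b) blocking
    have hLs : ∀ ⦃u v : Site 2⦄, zdStarGraph.Adj u v → supLevel x₀ v ≤ supLevel x₀ u + 1 :=
      fun u v h ↦ supLevel_le_of_zdStarGraph_adj x₀ h
    obtain ⟨u, v, π', hu, hv, hlev, hsub⟩ := exists_subwalk_in_band (supLevel x₀) hLs
      (lo := 6 * n) (hi := 12 * n) (by omega) π (by omega) (by omega)
    obtain ⟨i, ε, hiv⟩ := exists_units_mul_eq_of_max_abs_eq (x := v - x₀) (m := 12 * n) hv
    have hH' : ∀ ⦃y z : Site 2⦄, zdStarGraph.Adj y z → (ε : ℤ) * (y - x₀) i ≤ (ε : ℤ) * (z - x₀) i + 1 :=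
      fun y z h ↦ units_mul_sub_le_of_zdStarGraph_adj x₀ i ε h.symm
    obtain ⟨w, π'', hw, hge, hsub'⟩ := exists_suffix_from_level (fun z ↦ (ε : ℤ) * (z - x₀) i) hH' π'
      (lo := 6 * n) ((units_mul_le_max_abs (u - x₀) i ε).trans hu.le) (by rw [hiv]; omega)
    have hQ : ∀ z ∈ π''.support, InRect n i ε (z - x₀) := fun z hz ↦ by
      have hz' := hlev z (hsub' hz)
      exact ⟨hge z hz, (units_mul_le_max_abs (z - x₀) i ε).trans hz'.2,
        (abs_rev_le_supLevel x₀ i z).trans hz'.2⟩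
    have ha' : (ι (s i ε) - x₀) i.rev = -(12 * n) := by
      have := hsIn i ε; rw [rectIn, Finset.mem_filter] at this; exact this.2.2
    have hb' : (ι (b i ε) - x₀) i.rev = 12 * n := by
      have := hbOut i ε; rw [rectOut, Finset.mem_filter] at this; exact this.2.2
    obtain ⟨z, hzP, hzQ⟩ := exists_mem_support_rect_star x₀ i ε (P i ε) π'' (hPin i ε) hQ ha' hb' hw hiv
    obtain ⟨v', hv', hreach⟩ := hPreach i ε z hzP
    exact ⟨z, hsub (hsub' hzQ), i, ε, v', hv', hreach⟩

end Seeds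

end Literature.Probability.LatticeModels

end
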